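import Mathlib
import HarnessLib
import Summits.ResolutionOfSingularities.ResolutionOfSingularities.Theorems.HomologicalConductorPersistenceKC3Witness
import Summits.ResolutionOfSingularities.ResolutionOfSingularities.Theorems.HomologicalConductorPersistenceFaithfullyFlatDescent

/-!
# Crux `Persistence` (stmt-ResolutionOfSingularities-16484), chain W4.4b — K-C3 K4c (abstract half):
# transporting the `X_b` certificate to ANY ring mapping to `k(a,b,c)` with unit-constant denominators

Route `ResolutionOfSingularities/HomologicalConductor`.  OURS (cell res-hironaka, crux chain W4.4b,
K-C3-REPRO.md 40352614fdfe8abf §7 «K4c: transport along x ↦ a⁶, z ↦ a⁴b, t ↦ a³c, clear denominators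
of loc O W (constant term ≠ 0), apply (e); then U7-matrix criterion»; CHAIN v13.3 ASSIGN v1.9 «058:
K4a/b; then K4c»; seat res-D-pv-058); nothing here is a statement of the manuscript under review
(Hironaka 2017); AI-written, weaker than expert review.

This file is the RING-AGNOSTIC part of K4c.  `T` is any commutative ring (the consumer: the tower
stage `T₁ = ↥(loc O W)`), `L` any commutative `k[a,b,c]`-algebra with injective structure map (the
consumer: `k(a,b,c)` or `k(x,z,t) ↪ k(a,b,c)`), `Φ : T →+* L` a ring map (the dictionary
`x ↦ a⁶, z ↦ a⁴b, t ↦ a³c` on `T₁`), `D : Matrix (Fin 8) (Fin 12) T` a matrix mapping under `Φ` to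
the witness presentation `kc3D` (`X_b` presented over `T`), `x : T` mapping to `a⁶`, and the
DENOMINATOR HYPOTHESIS: every `Φ e`, `e ∈ T`, is `w / s` with `w, s ∈ k[a,b,c]`, `s(0) ≠ 0`.

* `stablyAnnihilates_coker_iff_exists_mul_mul_eq'` — the sandwich criterion for RECTANGULAR
  presentations `Tⁿ —φ→ Tᵐ ↠ coker φ`: `x ∈ s̲ann(coker φ) ↔ ∃ B, φ B φ = x • φ` (sibling
  `exists_comp_eq_smul_id_iff_exists_sandwich`; square case = `PersistenceStableAnnihilatorMatrix`).
* **`not_stablyAnnihilates_coker_of_transport`** — under the hypotheses above, `x` does NOT stably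
  annihilate `coker D` over `T`: a sandwich `D B D = x • D` over `T` maps to `L`, a common denominator
  `S = ∏ s_{rg}` (`S(0) ≠ 0`) clears `Φ(B)` to a polynomial matrix `E'`, injectivity of
  `k[a,b,c] → L` pulls the identity back to `k[a,b,c]`, and `KC3Witness.not_exists_certificate S`
  (K4a/b) is contradicted.

The INSTANCE (`T = T₁ = ↥(loc O W)`, `Φ` = the dictionary on the chart ring, `D` = the `W`-presentation
of `X_b` with entries `zt/x, z²/x, z, t, x, t²/x, z³/x², …`, the denominator hypothesis from K3a's
monomial valuation) is K4c part 2, on top of res-D-pv-043's K3b / res-type-084's K3a.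
[OURS; elementary.]
-/

noncomputable section

-- single-problem summit: the doubled namespace component `ResolutionOfSingularities` is forced
set_option linter.dupNamespace false

open CategoryTheory MvPolynomial
open Summit.ResolutionOfSingularities.ResolutionOfSingularities.Theorems.NoZeno.SandwichCluster
open Summit.ResolutionOfSingularities.ResolutionOfSingularities.Theorems.HomologicalConductor.PersistenceFaithfullyFlatDescent
open Summit.ResolutionOfSingularities.ResolutionOfSingularities.Theorems.HomologicalConductor.KC3Witness

universe u v

namespace Summit.ResolutionOfSingularities.ResolutionOfSingularities.Theorems.HomologicalConductor.KC3WitnessTransport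

/-! ## The sandwich criterion for rectangular presentations -/

section Sandwich

variable {T : Type u} [CommRing T] {m n : Type} [Fintype n]

/-- `mulVecLin` is compatible with scalars (rectangular). [folklore] -/
theorem mulVecLin_smul' (x : T) (φ : Matrix m n T) : (x • φ).mulVecLin = x • φ.mulVecLin := by
  refine LinearMap.ext fun v => ?_
  simp

variable [DecidableEq n]

/-- `mulVecLin` is injective on rectangular matrices (`Matrix.toLin'` is an equivalence). [folklore] -/
theorem mulVecLin_injective' : Function.Injective (fun φ : Matrix m n T => φ.mulVecLin) := by
  intro φ ψ h
  have : Matrix.toLin' φ = Matrix.toLin' ψ := by simpa [Matrix.toLin'_apply'] using h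
  exact Matrix.toLin'.injective this

variable [Fintype m] [DecidableEq m]

/-- **The sandwich criterion, rectangular form.**  For `φ : Matrix m n T` (a presentation
`Tⁿ —φ→ Tᵐ ↠ coker φ = Tᵐ ⧸ range φ`) and `x ∈ T`: `x` stably annihilates `coker φ` iff
`φ B φ = x • φ` for some `B : Matrix n m T`. [folklore; cite: IyengarTakahashi2014, Remark 2.13] -/
theorem stablyAnnihilates_coker_iff_exists_mul_mul_eq' (φ : Matrix m n T) (x : T) :
    StablyAnnihilates T x (ModuleCat.of T ((m → T) ⧸ LinearMap.range φ.mulVecLin)) ↔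
      ∃ B : Matrix n m T, φ * B * φ = x • φ := by
  rw [stablyAnnihilates_iff_exists_comp_eq_smul_id x (LinearMap.range φ.mulVecLin).mkQ
      (Submodule.mkQ_surjective _),
    exists_comp_eq_smul_id_iff_exists_sandwich x φ.mulVecLin (LinearMap.range φ.mulVecLin).mkQ
      (LinearMap.exact_map_mkQ_range φ.mulVecLin) (Submodule.mkQ_surjective _)]
  constructor
  · rintro ⟨β, hβ⟩
    refine ⟨-LinearMap.toMatrix' β, ?_⟩
    apply mulVecLin_injective'
    simp only
    have hB : (-LinearMap.toMatrix' β).mulVecLin = -β := by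
      rw [← Matrix.toLin'_apply', map_neg, Matrix.toLin'_toMatrix']
    rw [Matrix.mulVecLin_mul, Matrix.mulVecLin_mul, mulVecLin_smul', hB, LinearMap.comp_neg,
      LinearMap.neg_comp, LinearMap.comp_assoc, hβ, neg_neg]
  · rintro ⟨B, hB⟩
    refine ⟨(-B).mulVecLin, ?_⟩
    have hneg : (-B).mulVecLin = -B.mulVecLin := by
      refine LinearMap.ext fun v => ?_
      simp
    rw [hneg, LinearMap.neg_comp, LinearMap.comp_neg, ← Matrix.mulVecLin_mul,
      ← Matrix.mulVecLin_mul, ← mulVecLin_smul', ← Matrix.mul_assoc, hB]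

end Sandwich

/-! ## Clearing denominators: the transport of K4a/b -/

section Transport

variable {k : Type u} [CommRing k] [IsDomain k] {T : Type u} [CommRing T] {L : Type v} [CommRing L]
  [Algebra (MvPolynomial (Fin 3) k) L]

/-- **K4c (abstract): no stable annihilation of `coker D` by `x` over `T`.**  `Φ : T →+* L` a
ring map into a `k[a,b,c]`-algebra `L` with injective structure map; `D : Matrix (Fin 8) (Fin 12) T`
with `Φ(D) = kc3D` and `Φ x = a⁶`; every `Φ e` (`e ∈ T`) of the form `w / s` with `w, s ∈ k[a,b,c]`,
`s(0) ≠ 0`.  Then `x` does not stably annihilate `coker D = T⁸ ⧸ D·T¹²` (= `X_b ⊗ T` for the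
consumer `T = T₁`): a sandwich `D B D = x • D` would map to `L`, clear to a polynomial identity
`kc3D E' kc3D = (S·a⁶) • kc3D` with `S(0) ≠ 0`, contradicting `KC3Witness.not_exists_certificate`.
[OURS · K-C3-REPRO §7 K4c] -/
theorem not_stablyAnnihilates_coker_of_transport (Φ : T →+* L)
    (hinj : Function.Injective (algebraMap (MvPolynomial (Fin 3) k) L))
    (D : Matrix (Fin 8) (Fin 12) T)
    (hD : D.map Φ = (kc3D k).map (algebraMap (MvPolynomial (Fin 3) k) L)) (x : T)
    (hx : Φ x = algebraMap (MvPolynomial (Fin 3) k) L (X 0 ^ 6))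
    (hden : ∀ e : T, ∃ w s : MvPolynomial (Fin 3) k,
      coeff 0 s ≠ 0 ∧ Φ e * algebraMap (MvPolynomial (Fin 3) k) L s =
        algebraMap (MvPolynomial (Fin 3) k) L w) :
    ¬ StablyAnnihilates T x (ModuleCat.of T ((Fin 8 → T) ⧸ LinearMap.range D.mulVecLin)) := by
  intro h
  obtain ⟨B, hB⟩ := (stablyAnnihilates_coker_iff_exists_mul_mul_eq' D x).mp h
  -- denominators entrywise
  choose w s hs hws using fun i : Fin 12 × Fin 8 => hden (B i.1 i.2)
  set S : MvPolynomial (Fin 3) k := ∏ i, s i with hSdef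
  have hS0 : coeff 0 S ≠ 0 := by
    rw [hSdef, ← constantCoeff_eq, map_prod]
    exact Finset.prod_ne_zero_iff.mpr fun i _ => by rw [constantCoeff_eq]; exact hs i
  -- the cleared matrix `E'` over `k[a,b,c]`
  let E' : Matrix (Fin 12) (Fin 8) (MvPolynomial (Fin 3) k) :=
    Matrix.of fun r g => w (r, g) * ∏ i ∈ Finset.univ.erase (r, g), s i
  have hE' : E'.map (algebraMap (MvPolynomial (Fin 3) k) L) =
      algebraMap (MvPolynomial (Fin 3) k) L S • B.map Φ := by
    ext r g
    simp only [Matrix.map_apply, Matrix.smul_apply, smul_eq_mul, E', Matrix.of_apply, map_mul,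
      map_prod]
    rw [← hws (r, g), hSdef, map_prod, ← Finset.mul_prod_erase Finset.univ _ (Finset.mem_univ (r, g))]
    ring
  -- map the sandwich to `L`, multiply by `S`
  have hBL : (kc3D k).map (algebraMap _ L) * B.map Φ * (kc3D k).map (algebraMap _ L) =
      Φ x • (kc3D k).map (algebraMap _ L) := by
    have := congrArg (fun M : Matrix (Fin 8) (Fin 12) T => M.map Φ) hB
    simp only [Matrix.map_mul, hD] at this
    rw [this]
    ext g r
    simp only [Matrix.map_apply, Matrix.smul_apply, smul_eq_mul, map_mul, ← hD]
  have key : ((kc3D k) * E' * (kc3D k)).map (algebraMap (MvPolynomial (Fin 3) k) L) =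
      ((S * X 0 ^ 6) • kc3D k).map (algebraMap (MvPolynomial (Fin 3) k) L) := by
    rw [Matrix.map_mul, Matrix.map_mul, hE', Matrix.mul_smul, Matrix.smul_mul, hBL, hx, smul_smul,
      ← map_mul]
    ext g r
    simp only [Matrix.map_apply, Matrix.smul_apply, smul_eq_mul, map_mul]
  have key' : (kc3D k) * E' * (kc3D k) = (S * X 0 ^ 6) • kc3D k :=
    Matrix.map_injective hinj key
  refine not_exists_certificate (k := k) S hS0 ⟨-E', ?_⟩
  rw [Matrix.mul_neg, Matrix.neg_mul, key']

end Transport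

end Summit.ResolutionOfSingularities.ResolutionOfSingularities.Theorems.HomologicalConductor.KC3WitnessTransport
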